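import Summits.CriticalPhenomena.PercolationContinuityZ3.Theorems.Transplant.SkelPhiWinChainS
import Summits.CriticalPhenomena.PercolationContinuityZ3.Theorems.Transplant.PlanarCells2InnerRun
import Summits.CriticalPhenomena.PercolationContinuityZ3.Theorems.Transplant.SkelPhiCellsConcG
import HarnessLib

/-!
# D″ node, (F) part 5b at φ-level (DPRIME-SCOPE §2 L6′, p3 addendum M / rulings R1–R3 2026-08-21T05:09:29Z, M.9 05:36:36Z; hp-8 column): the INNER
# ROUTE of a deep face-step contact IN WINDOW FORM — the inner band run `Skelφ.innerSched …` as a `ChainPlanar.Schedule` (p1-g9's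
# `Band.scheduleR` over my `PCells2.InnerRunOK2` / `innerRun_bandOK`), read through the planar window `Skelφ.planarWindowWin hlip c L_A`
# about its SOURCE `c` (the contact's kit centre; p1-g9's `SkelPhiWinChainS`), the route world `Skelφ.schedQt` (first-hop footprint ∪ the
# regions), and the containments the face residue owes: regions inside the face-step window over `farAS`, far face inside the target SPAN
# `M_{a'}(x + du)`, regions above a given signed level (the seed) — φ-level successor of `SkelConcFaceInnerRoute` (hp-8 g24, p236479; there
# `Skel.innerWAD : WinAdvData` over one-unit squares)

builds on p205010 (kernel theorem, internal audit signed; external expert review pending) — nothing in this file uses p205010.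
Lane `prim-bschramm`, seat `prim-hp-8` (gen 30; L6′ (F) owner); helper file (`--supports stmt-CriticalPhenomena-4575`).  Hypotheses through
p3-g7's dictionary: `hlip : Skelφ.Lip G φ` (the planar window), `hstep : Skelφ.Steps G φ` (the step device into the target span); data: the
two-unit cells `P : PCells2`, the macro-vertex `x`, the onward direction `du`, the source vertex `c`, the window depth `L`, the inner run's
parameters (`ca cb q q' s₁ R' ℓ₀ nA WM Wb ℓ₁`) packaged by `h : PCells2.InnerRunOK2 …`.  The schedule's regions are the ROOTED band regions
`Band.regionR` (region `0` reaching `ρ₀ = 3q + s₁ + 2R'` below the start box), so a start box placed above the seed's planar shadow keeps every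
region clear of the (wired) seed — the transfer `WinChainData.lt_real_of_chainS` (p1-g9) is then applied by the consumer with
`𝒲 := planarWindowWin hlip c L`, `S := innerSched …`.
* §1 (any schedule `S`, any source `c`, depth `L`, first-hop footprint `F`): `schedQt G φ c L F S := Win c (F ∪ ⋃_{k ≤ N} S.region k) L`,
  `stepD_subset_schedQt`, `first_subset_schedQt`, `mem_graphBall_of_mem_schedQt`, `mem_schedQt_of_φ_mem`, **`schedQt_subset_Win`**,
  `schedRim` (the region-`k` vertices beyond depth `L − L'` from `c`) / `schedRim_subset_stepD`, `disjoint_Win_of_φ` (window vs. any vertex set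
  by planar footprints);
* §2 (the inner run): **`innerSched … h hℓ₁ : ChainPlanar.Schedule`** (+ simp/`rfl` readings), **`innerSched_region_subset_farAS`**,
  `PCells2.exists_adj_of_mem_M`, **`innerSched_coreT_subset_M (hlip) (hstep)`** (far face in the target span, ONE unit of depth slack:
  `B_G(c, L) ⊆ B_G(w₀, R₁')`, `R₁' + 1 ≤ rM_{a'}(x+du)` — design event D3 of the node of record), `lev_ge_of_mem_innerSched_region`,
  **`disjoint_stepD_of_lev_lt`** / `disjoint_coreT_of_lev_lt` (every vertex set whose footprints sit below level `ca − ρ₀` misses the regions /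
  the targets — the wired seed below the first hop).
[cite: KozmaNitzan2024, §4 Lemma 10 Step IV (pp. 19–21), Lemma 11 (pp. 22–23: Ω, the slabs, the first cube), p. 30 (Step III)]
-/

noncomputable section

open MeasureTheory
open scoped Classical

namespace Summit.CriticalPhenomena.PercolationContinuityZ3.Theorems.Transplant

namespace Skelφ

open Literature.Probability.Percolation Literature.Probability.LatticeModels SimpleGraph KNLevels ChainPlanar
open Literature.Probability.Percolation.KozmaNitzan
open Literature.Probability.Percolation.KozmaNitzan.Cells (oth oth_ne eq_oth_of_ne sgOf sgOf_sign stepVec_apply_fst stepVec_apply_oth)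
open Literature.Barriers.CriticalPhenomena (graphBall graphBall_finite mem_graphBall_self graphBall_mono)
open BoxProdZ2 (ConcRadiiG sg_mul_sub_add)
open Skel (winGraph)
open PCells (mem_psBox_iff)

variable {V : Type} [DecidableEq V] (G : SimpleGraph V) [G.LocallyFinite] (φ : V → Site 2)

/-! ## §1 The route world of a schedule about a source -/

/-- **The route world of a chain about its source `c`**: the window of depth `L` about `c` over the first-hop footprint `F` and the regions
`S.region k`, `k ≤ S.N` (φ-level successor of `Skel.innerQt`). [cite: KozmaNitzan2024, §4 Lemma 11 (p. 22: Ω)] -/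
def schedQt (c : V) (L : ℕ) (F : Finset (Site 2)) (S : Schedule) : Finset V :=
  Win G φ c (F ∪ (Finset.range (S.N + 1)).biUnion S.region) L

/-- **The rim part of region `k`**: the region-`k` window vertices beyond depth `L − L'` from the source. [cite: KozmaNitzan2024, §4 p. 30] -/
def schedRim (c : V) (L L' : ℕ) (S : Schedule) (k : ℕ) : Finset V :=
  (Win G φ c (S.region k) L).filter fun v => v ∉ graphBall G c (L - L')

variable {G φ}

/-- Every region window lies in the route world (`k ≤ N`). [folklore] -/
theorem stepD_subset_schedQt (hlip : Lip G φ) {c : V} {L : ℕ} (F : Finset (Site 2)) {S : Schedule} {k : ℕ} (hk : k ≤ S.N) :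
    (planarWindowWin hlip c L).stepD S k ⊆ schedQt G φ c L F S := by
  intro u hu
  rw [PlanarWindow.stepD, planarWindowWin_W, mem_Win] at hu
  rw [schedQt, mem_Win]
  refine ⟨hu.1, Finset.mem_union_right _ ?_⟩
  exact Finset.mem_biUnion.2 ⟨k, Finset.mem_range.2 (Nat.lt_succ_of_le hk), hu.2⟩

omit [DecidableEq V] in
/-- The first-hop window lies in the route world. [folklore] -/
theorem first_subset_schedQt {c : V} {L : ℕ} (F : Finset (Site 2)) (S : Schedule) : Win G φ c F L ⊆ schedQt G φ c L F S :=
  Win_mono G φ Finset.subset_union_left le_rfl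

omit [DecidableEq V] in
/-- Route-world vertices lie within depth `L` of the source. [folklore] -/
theorem mem_graphBall_of_mem_schedQt {c : V} {L : ℕ} {F : Finset (Site 2)} {S : Schedule} {u : V} (hu : u ∈ schedQt G φ c L F S) :
    u ∈ graphBall G c L :=
  ((mem_Win G φ).1 hu).1

omit [DecidableEq V] in
/-- A vertex within depth `L` whose footprint lies in `F` lies in the route world. [folklore] -/
theorem mem_schedQt_of_φ_mem {c : V} {L : ℕ} {F : Finset (Site 2)} {S : Schedule} {u : V} (hu : u ∈ graphBall G c L) (hφ : φ u ∈ F) :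
    u ∈ schedQt G φ c L F S :=
  (mem_Win G φ).2 ⟨hu, Finset.mem_union_left _ hφ⟩

omit [DecidableEq V] in
/-- **The route world lies in a window about another centre** once `B_G(c, L) ⊆ B_G(w₀, R)` and every planar piece lies in `Pl`.
[cite: KozmaNitzan2024, §4 Lemma 11 (p. 22: Ω ⊆ the far region)] -/
theorem schedQt_subset_Win {c w₀ : V} {L R : ℕ} (hball : graphBall G c L ⊆ graphBall G w₀ R) {F Pl : Finset (Site 2)} {S : Schedule}
    (hF : F ⊆ Pl) (hS : ∀ k ≤ S.N, S.region k ⊆ Pl) : schedQt G φ c L F S ⊆ Win G φ w₀ Pl R := by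
  intro u hu
  obtain ⟨hu1, hu2⟩ := (mem_Win G φ).1 hu
  refine (mem_Win G φ).2 ⟨hball hu1, ?_⟩
  rcases Finset.mem_union.1 hu2 with h | h
  · exact hF h
  · obtain ⟨k, hk, hk'⟩ := Finset.mem_biUnion.1 h
    exact hS k (Nat.le_of_lt_succ (Finset.mem_range.1 hk)) hk'

omit [DecidableEq V] in
/-- Planar footprints of route-world vertices differ coordinatewise by at most the planar diameter of `Pl` (for the excess radius).
[folklore] -/
theorem φ_mem_of_mem_schedQt {c : V} {L : ℕ} {F Pl : Finset (Site 2)} {S : Schedule} (hF : F ⊆ Pl) (hS : ∀ k ≤ S.N, S.region k ⊆ Pl)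
    {u : V} (hu : u ∈ schedQt G φ c L F S) : φ u ∈ Pl :=
  ((mem_Win G φ).1 (schedQt_subset_Win (le_refl (graphBall G c L)) hF hS hu)).2

/-- The rim part of region `k` lies in the region window. [folklore] -/
theorem schedRim_subset_stepD (hlip : Lip G φ) (c : V) (L L' : ℕ) (S : Schedule) (k : ℕ) :
    schedRim G φ c L L' S k ⊆ (planarWindowWin hlip c L).stepD S k := by
  intro u hu
  rw [schedRim, Finset.mem_filter] at hu
  rw [PlanarWindow.stepD, planarWindowWin_W]
  exact hu.1

omit [DecidableEq V] in
/-- A window misses every vertex set whose planar footprints miss its planar set. [folklore] -/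
theorem disjoint_Win_of_φ {c : V} {Pl : Finset (Site 2)} {L : ℕ} {K : Finset V} (hK : ∀ z ∈ K, φ z ∉ Pl) : Disjoint (Win G φ c Pl L) K :=
  Finset.disjoint_left.2 fun u hu huK => hK u huK ((mem_Win G φ).1 hu).2

/-! ## §2 The inner schedule of a face-step contact (two units) -/

section Inner

variable (P : PCells2) (x : Site 2) (du : MDir) {ca cb q q' s₁ : ℤ} {R' ℓ₀ nA WM : ℕ} {Wb : ℕ → ℕ} {j : ℕ}
  (h : PCells2.InnerRunOK2 P du j s₁ R' ℓ₀ nA ca cb q q' WM Wb) {ℓ₁ : ℕ} (hℓ₁ : 2 * q + s₁ + R' ≤ ℓ₁)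

/-- **The inner band run of a face-step contact as a planar schedule**: p1-g9's rooted band schedule `Band.scheduleR` along `du` about the
centre `innerCtr2 P x du ca cb`, with the admissibility of `PCells2.innerRun_bandOK`. [cite: KozmaNitzan2024, §4 Lemma 11 (pp. 22–23)] -/
def innerSched : Schedule :=
  Band.scheduleR du.1 (sgOf_sign du) (PCells2.innerCtr2 P x du ca cb) (PCells2.innerRun_bandOK h) hℓ₁

/-- The regions of the inner schedule are the rooted band regions. [folklore] -/
@[simp] theorem innerSched_region (k : ℕ) : (innerSched P x du h hℓ₁).region k =
    Band.regionR q s₁ (PCells2.innerρB q q' s₁ R' nA WM) R' du.1 (sgOf du) (PCells2.innerCtr2 P x du ca cb) k := rfl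

/-- The cores of the inner schedule are the band cores. [folklore] -/
@[simp] theorem innerSched_core (k : ℕ) : (innerSched P x du h hℓ₁).core k =
    Band.core q q' s₁ R' WM du.1 (sgOf du) (PCells2.innerCtr2 P x du ca cb) k := by
  rw [innerSched, Band.scheduleR_core]

/-- The number of advance steps of the inner schedule. [folklore] -/
@[simp] theorem innerSched_N : (innerSched P x du h hℓ₁).N = nA := rfl

/-- The neighbourhood radius of the inner schedule. [folklore] -/
@[simp] theorem innerSched_R' : (innerSched P x du h hℓ₁).R' = R' := rfl

/-- The axis of the inner schedule. [folklore] -/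
@[simp] theorem innerSched_ax (k : ℕ) : (innerSched P x du h hℓ₁).ax k = du.1 := rfl

/-- The extent range of the inner schedule. [folklore] -/
theorem innerSched_ℓ : (innerSched P x du h hℓ₁).ℓ₀ = ℓ₀ ∧ (innerSched P x du h hℓ₁).ℓ₁ = ℓ₁ := ⟨rfl, rfl⟩

/-- **Every region of the inner schedule lies in the shrunk far rows `farAS x du j`** (`k ≤ nA`). [cite: KozmaNitzan2024, §4 Lemma 11 (p. 22: Ω)] -/
theorem innerSched_region_subset_farAS {k : ℕ} (hk : k ≤ nA) : (innerSched P x du h hℓ₁).region k ⊆ P.farAS x du j := by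
  rw [innerSched_region]; exact PCells2.innerRun_regionR_subset_farAS h hk

omit [DecidableEq V] in
/-- **The route world of the inner schedule lies in the face-step window over `farAS x du j`**, for a first-hop footprint `F ⊆ farAS` and
`B_G(c, L) ⊆ B_G(w₀, R)`. [cite: KozmaNitzan2024, §4 Lemma 11 (p. 22), p. 30] -/
theorem innerSchedQt_subset_Win_farAS {c w₀ : V} {L R : ℕ} (hball : graphBall G c L ⊆ graphBall G w₀ R) {F : Finset (Site 2)}
    (hF : F ⊆ P.farAS x du j) : schedQt G φ c L F (innerSched P x du h hℓ₁) ⊆ Win G φ w₀ (P.farAS x du j) R :=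
  schedQt_subset_Win hball hF fun k hk => innerSched_region_subset_farAS P x du h hℓ₁ (by simpa using hk)

omit [DecidableEq V] in
/-- Self-adjacency of the target cube `cen v ± 3 (r₀, r₁)` (two units). [folklore] -/
theorem _root_.Summit.CriticalPhenomena.PercolationContinuityZ3.Theorems.Transplant.PCells2.exists_adj_of_mem_M (P : PCells2) (v : Site 2)
    {t : Site 2} (ht : t ∈ P.M v) : ∃ t' ∈ P.M v, (zdGraph 2).Adj t t' :=
  PCells.exists_adj_of_mem_Icc 0 (by simp only [Pi.sub_apply, Pi.add_apply, PCells2.hw_apply]; push_cast; have := P.one_le_r 0; omega) ht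

/-- **The far face of the inner schedule lies in the target SPAN `M_{a'}(x + du)`** (from `Lip`, `Steps`): with ONE unit of depth slack —
`B_G(c, L) ⊆ B_G(w₀, R₁')`, `R₁' + 1 ≤ rM_{a'}(x + du)` — the step device puts the far-core window into the span (design event D3).
[cite: KozmaNitzan2024, §4 p. 26 (M_v), Lemma 11 (p. 23: the last face)] -/
theorem innerSched_coreT_subset_M (hlip : Lip G φ) (hstep : Steps G φ) {c w₀ : V} {L : ℕ} {Λ : ConcRadiiG} {a' : ℕ} {R₁' : ℕ}
    (hball : graphBall G c L ⊆ graphBall G w₀ R₁') (hR : R₁' + 1 ≤ Λ.rM a' (x + stepVec du)) :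
    (planarWindowWin hlip c L).coreT (innerSched P x du h hℓ₁) nA ⊆ (cellGeomSG G φ P w₀ Λ).M a' (x + stepVec du) := by
  intro u hu
  rw [PlanarWindow.coreT, planarWindowWin_W, innerSched_core, mem_Win] at hu
  obtain ⟨hu1, hu2⟩ := hu
  have hM : φ u ∈ P.M (x + stepVec du) := PCells2.innerRun_last_subset_M h hu2
  change u ∈ VWin G φ w₀ (P.M (x + stepVec du)) (Λ.rM a' (x + stepVec du))
  exact mem_VWin_of_zdAdj hstep (hball hu1) hR hM (P.exists_adj_of_mem_M _ hM)

omit [DecidableEq V] [G.LocallyFinite] in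
/-- **Every point of a region `k ≤ nA` of the inner schedule has signed level `≥ ca − (3q + s₁ + 2R')`** (the rooted regions start above the
seed). [cite: KozmaNitzan2024, §4 Lemma 11 (p. 22: Ω)] -/
theorem lev_ge_of_mem_innerSched_region {k : ℕ} (hk : k ≤ nA) {y : Site 2} (hy : y ∈ (innerSched P x du h hℓ₁).region k) :
    ca - (3 * q + s₁ + 2 * R') ≤ P.lev du x y := by
  rw [innerSched_region] at hy
  have hy' := Band.regionR_subset_prism (sgOf_sign du) (PCells2.innerCtr2 P x du ca cb) (PCells2.innerRun_bandOK h) hk hy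
  rw [mem_psBox_iff] at hy'
  simp only [PCells2.innerCtr2_fst, sg_mul_sub_add, Adv.ρ₀] at hy'
  rw [PCells2.lev_def]
  linarith [hy'.1.1]

/-- **The region windows miss every vertex set below level `ca − (3q + s₁ + 2R')`** (the wired seed below the first hop).
[cite: KozmaNitzan2024, §4 Lemma 11 (p. 22: the first cube)] -/
theorem disjoint_stepD_of_lev_lt (hlip : Lip G φ) {c : V} {L : ℕ} {k : ℕ} (hk : k ≤ nA) {K : Finset V}
    (hK : ∀ z ∈ K, P.lev du x (φ z) < ca - (3 * q + s₁ + 2 * R')) :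
    Disjoint ((planarWindowWin hlip c L).stepD (innerSched P x du h hℓ₁) k) K := by
  rw [PlanarWindow.stepD, planarWindowWin_W]
  refine disjoint_Win_of_φ fun z hz hzR => ?_
  have h1 := lev_ge_of_mem_innerSched_region P x du h hℓ₁ hk hzR
  have h2 := hK z hz
  omega

/-- **The true targets miss every vertex set below level `ca − (3q + s₁ + 2R')`.** [folklore] -/
theorem disjoint_coreT_of_lev_lt (hlip : Lip G φ) {c : V} {L : ℕ} {k : ℕ} (hk : k ≤ nA) {K : Finset V}
    (hK : ∀ z ∈ K, P.lev du x (φ z) < ca - (3 * q + s₁ + 2 * R')) :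
    Disjoint ((planarWindowWin hlip c L).coreT (innerSched P x du h hℓ₁) k) K :=
  (disjoint_stepD_of_lev_lt P x du h hℓ₁ hlip hk hK).mono_left
    ((planarWindowWin hlip c L).coreT_subset_stepD (innerSched P x du h hℓ₁) (by simpa using hk))

end Inner

end Skelφ

end Summit.CriticalPhenomena.PercolationContinuityZ3.Theorems.Transplant

end
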